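import Literature.Geometry.Lorentzian.StationaryOrbitHorizontalFlow
import Literature.Geometry.Lorentzian.KillingFlowIsometry
import Mathlib.Analysis.Calculus.InverseFunctionTheorem.FDeriv
import HarnessLib

/-!
# The asymptotic region `M_ext = ⋃ₜ φₜ(Σ_ext')` of a stationary AF black hole is open

Chruściel–Costa, *On uniqueness of stationary vacuum black holes*, Astérisque 321 (2008) =
arXiv:0806.0016, §2.2, (2.1): for a space-time `(M, g)` with complete stationary Killing field `K`
and an asymptotically flat end `Σ_ext` of a spacelike hypersurface, the *exterior region* is
`M_ext := ⋃ₜ φₜ[K](Σ_ext)`, and the domain of outer communications is `⟨⟨M_ext⟩⟩ = I⁺(M_ext) ∩ I⁻(M_ext)`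
((2.2)). Throughout the paper `M_ext` is treated as an open region of `M` (e.g. "the asymptotically
flat region `M_ext`", §3; "`𝒜` … extends into `M_ext`", §5–§6): `K` is timelike on `Σ_ext`, hence
transversal to the spacelike hypersurface `Σ_ext`, so the flow-out map `(t, y) ↦ φₜ(y)`,
`ℝ × Σ_ext → M`, is a local diffeomorphism and its image `M_ext` is open.

For the tree's `StationaryAFBlackHole` (`Stationary.lean`: `𝓑.Mext = stationaryOrbit T (embed '' e.far (e.R + 1))`,
the orbit of the embedded far region `Σ_ext' = e.far (e.R + 1)` of the AF end under the integral
curves of the stationary Killing field `T = 𝓑.killing`) we prove exactly this: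

* `map_nhds_eq_of_mfderiv_surjective` — **open mapping at a point**: a map between boundaryless
  manifolds which is `C¹` at `x` with surjective differential `df_x` maps neighbourhoods of `x` onto
  neighbourhoods of `f x` (the submersion half of the inverse function theorem; Mathlib's
  `HasStrictFDerivAt.map_nhds_eq_of_surj` read in extended charts), and
  `isOpen_image_of_mfderiv_surjective` — the image of an open set on which this holds is open
  (Lee 2012, Prop. 4.28: submersions are open maps);
* `StationaryAFBlackHole.Mext_eq_image_flowOut` — `M_ext = Φ(ℝ × Σ_ext')` for the flow-out map
  `Φ(t, y) = θ(t, embed y)` of the stationary flow `θ` (uniqueness of integral curves);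
* `StationaryAFBlackHole.mfderiv_flowOut_surjective` — `dΦ_{(t, y)}` is onto: `dΦ(τ, w) =
  dθₜ(τ T + d(embed) w)` (`dθₜ T = T ∘ θₜ`, chain rule), `dθₜ` is invertible, and
  `(τ, w) ↦ τ T_{x₀} + d(embed)_{y} w` is injective — `T_{x₀}` is timelike (`x₀ = embed y ∈ M_ext`)
  while `g(d(embed) w, d(embed) w) = h(w, w) ≥ 0` (the induced metric is the Riemannian `h` of the
  data) — hence bijective by the dimension count `1 + 3 = 4`;
* **`StationaryAFBlackHole.isOpen_Mext` — `M_ext` is open**, with `Mext_mem_nhds`.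

Everything is proved; no new definitions besides the proofs, no named facts.

## References

* P. T. Chruściel, J. L. Costa, Astérisque 321 (2008) 195–265, arXiv:0806.0016, §2.2, (2.1)–(2.2).
  [ChruscielCosta2008]
* J. M. Lee, *Introduction to Smooth Manifolds*, 2nd ed., Springer GTM 218 (2012), Thm. 4.5
  (inverse function theorem), Prop. 4.28 (submersions are open), Thm. 9.12, Thm. 9.20 (flow-outs).
  [LeeSmoothManifolds2013]
* B. O'Neill, *Semi-Riemannian Geometry*, Academic Press (1983), Ch. 5, Lemma 26 ff. [ONeillSemiRiemannian1983]
-/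

noncomputable section

universe u

open Set Filter Function Manifold
open scoped Manifold ContDiff Topology

namespace Literature.Geometry.Lorentzian

/-! ### Open mapping at a point from a surjective differential -/

section OpenMapping

variable {E : Type*} [NormedAddCommGroup E] [NormedSpace ℝ E] [CompleteSpace E] {H : Type*}
  [TopologicalSpace H] {I : ModelWithCorners ℝ E H} [I.Boundaryless] {M : Type*}
  [TopologicalSpace M] [ChartedSpace H M]
  {E' : Type*} [NormedAddCommGroup E'] [NormedSpace ℝ E'] [CompleteSpace E'] {H' : Type*}
  [TopologicalSpace H'] {I' : ModelWithCorners ℝ E' H'} [I'.Boundaryless] {M' : Type*}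
  [TopologicalSpace M'] [ChartedSpace H' M']

/-- **Open mapping at a point.** A map between boundaryless manifolds which is `C¹` at `x` and whose
differential `df_x` is onto maps the neighbourhood filter of `x` onto that of `f x` — the
submersion half of the inverse function theorem (Lee 2012, Thm. 4.5 and Prop. 4.28), obtained from
Mathlib's normed-space statement `HasStrictFDerivAt.map_nhds_eq_of_surj` in extended charts.
[cite: LeeSmoothManifolds2013, Prop. 4.28] -/
theorem map_nhds_eq_of_mfderiv_surjective {f : M → M'} {x : M} (hf : ContMDiffAt I I' 1 f x)
    (hsurj : Surjective (mfderiv I I' f x)) : map f (𝓝 x) = 𝓝 (f x) := by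
  set e := extChartAt I x with he
  set e' := extChartAt I' (f x) with he'
  set F : E → E' := writtenInExtChartAt I I' x f with hF
  have hcont : ContinuousAt f x := hf.continuousAt
  -- the written map is `C¹`, hence strictly differentiable, with onto derivative
  have hFd : ContDiffWithinAt ℝ 1 F (range I) (e x) := (contMDiffAt_iff.1 hf).2
  rw [ModelWithCorners.Boundaryless.range_eq_univ, contDiffWithinAt_univ] at hFd
  have hstrict : HasStrictFDerivAt F (fderiv ℝ F (e x)) (e x) := hFd.hasStrictFDerivAt one_ne_zero
  have hmf : mfderiv I I' f x = fderiv ℝ F (e x) := by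
    rw [(hf.mdifferentiableAt one_ne_zero).mfderiv, ModelWithCorners.Boundaryless.range_eq_univ,
      fderivWithin_univ]
  have hrange : (fderiv ℝ F (e x)).range = ⊤ :=
    LinearMap.range_eq_top.2 (by rw [← hmf]; exact hsurj)
  have hFmap : map F (𝓝 (e x)) = 𝓝 (F (e x)) := hstrict.map_nhds_eq_of_surj hrange
  -- transport through the charts
  have h1 : map e (𝓝 x) = 𝓝 (e x) := map_extChartAt_nhds_of_boundaryless x
  have h3 : map e'.symm (𝓝 (e' (f x))) = 𝓝 (f x) := by
    have h := map_extChartAt_symm_nhdsWithin_range (I := I') (f x)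
    rwa [ModelWithCorners.Boundaryless.range_eq_univ, nhdsWithin_univ] at h
  have hFx : F (e x) = e' (f x) := by
    simp only [hF, writtenInExtChartAt, he, he', Function.comp_apply, extChartAt_to_inv]
  have heq : f =ᶠ[𝓝 x] e'.symm ∘ F ∘ e := by
    filter_upwards [extChartAt_source_mem_nhds (I := I) x,
      hcont.preimage_mem_nhds (extChartAt_source_mem_nhds (I := I') (f x))] with y hy hy'
    simp only [Function.comp_apply, hF, writtenInExtChartAt, he, he']
    rw [PartialEquiv.left_inv _ hy, PartialEquiv.left_inv _ hy']
  rw [Filter.map_congr heq, ← Filter.map_map, ← Filter.map_map, h1, hFmap, hFx, h3]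

/-- **The image of an open set under a map with onto differentials is open** (Lee 2012,
Prop. 4.28: submersions are open maps; pointwise form). [cite: LeeSmoothManifolds2013, Prop. 4.28] -/
theorem isOpen_image_of_mfderiv_surjective {f : M → M'} {U : Set M} (hU : IsOpen U)
    (hf : ∀ x ∈ U, ContMDiffAt I I' 1 f x) (hsurj : ∀ x ∈ U, Surjective (mfderiv I I' f x)) :
    IsOpen (f '' U) := by
  rw [isOpen_iff_mem_nhds]
  rintro _ ⟨x, hx, rfl⟩
  rw [← map_nhds_eq_of_mfderiv_surjective (hf x hx) (hsurj x hx)]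
  exact image_mem_map (hU.mem_nhds hx)

end OpenMapping

/-! ### `M_ext` is the image of the flow-out map, whose differential is onto -/

namespace StationaryAFBlackHole

variable (𝓑 : StationaryAFBlackHole.{u}) [𝓑.metric.HasLeviCivita]

/-- **`M_ext = Φ(ℝ × Σ_ext')`** for the flow-out map `Φ(t, y) = θ(t, embed y)` of any flow `θ` of
the stationary Killing field with `θ₀ = id`: an integral curve `γ` of `T` with `γ(0) = embed y` is
`t ↦ θ(t, embed y)` (uniqueness of integral curves, `eq_flow_of_isMIntegralCurve`).
Chruściel–Costa 2008, (2.1). [cite: ChruscielCosta2008, §2.2 (2.1)] -/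
theorem Mext_eq_image_flowOut {θ : ℝ × 𝓑.carrier → 𝓑.carrier} (hθ0 : ∀ p, θ (0, p) = p)
    (hθX : ∀ p, IsMIntegralCurve (fun t ↦ θ (t, p)) 𝓑.killing) :
    𝓑.Mext = (fun q : ℝ × 𝓑.X ↦ θ (q.1, 𝓑.embed q.2)) '' (univ ×ˢ 𝓑.e.far (𝓑.e.R + 1)) := by
  have hT1 : ContMDiff (𝓡 4) (𝓡 4).tangent 1
      (fun x ↦ (⟨x, 𝓑.killing x⟩ : TangentBundle (𝓡 4) 𝓑.carrier)) :=
    𝓑.isStationaryKilling.isKillingField.contMDiff.of_le (WithTop.coe_le_coe.mpr le_top)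
  ext z
  constructor
  · rintro ⟨γ, hγ, ⟨y, hy, hγ0⟩, t, rfl⟩
    refine ⟨(t, y), ⟨mem_univ _, hy⟩, ?_⟩
    simp only
    rw [hγ0]
    exact (eq_flow_of_isMIntegralCurve hT1 hθX hθ0 hγ t).symm
  · rintro ⟨⟨t, y⟩, ⟨-, hy⟩, rfl⟩
    exact ⟨fun s ↦ θ (s, 𝓑.embed y), hθX _, ⟨y, hy, (hθ0 _).symm⟩, t, rfl⟩

omit [𝓑.metric.HasLeviCivita] in
/-- The flow-out map `Φ(t, y) = θ(t, embed y)` is `C^∞` for a `C^∞` flow `θ`. [folklore] -/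
theorem contMDiff_flowOut {θ : ℝ × 𝓑.carrier → 𝓑.carrier}
    (hθ : ContMDiff (𝓘(ℝ, ℝ).prod (𝓡 4)) (𝓡 4) ∞ θ) :
    ContMDiff (𝓘(ℝ, ℝ).prod (𝓡 3)) (𝓡 4) ∞ (fun q : ℝ × 𝓑.X ↦ θ (q.1, 𝓑.embed q.2)) :=
  hθ.comp (contMDiff_fst.prodMk (𝓑.isSmoothEmbedding.contMDiff.comp contMDiff_snd))

omit [𝓑.metric.HasLeviCivita] in
/-- **Transversality of `T` to `Σ_ext'`: `(τ, w) ↦ τ T_{x₀} + d(embed)_y w` is injective** at every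
point `x₀ = embed y` at which `T` is timelike: from `τ T + d(embed) w = 0`,
`h(w, w) = g(d(embed) w, d(embed) w) = τ² g(T, T) ≤ 0` (the induced metric is the Riemannian metric
`h` of the data), so `w = 0` and then `τ T = 0`, `τ = 0`. O'Neill 1983, Ch. 5 (a timelike vector is
never tangent to a spacelike hypersurface). [cite: ONeillSemiRiemannian1983, Ch. 5, Lemma 26] -/
theorem injective_smul_killing_add_mfderiv_embed (y : 𝓑.X)
    (hT : 𝓑.metric.IsTimelike (𝓑.killing (𝓑.embed y))) :
    Injective (fun v : ℝ × EuclideanSpace ℝ (Fin 3) ↦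
      v.1 • (𝓑.killing (𝓑.embed y) : E4) +
        (mfderiv (𝓡 3) (𝓡 4) 𝓑.embed y : EuclideanSpace ℝ (Fin 3) →L[ℝ] E4) v.2) := by
  -- everything in the model spaces `ℝ × ℝ³ → ℝ⁴`
  obtain ⟨T, hTd⟩ : ∃ T : E4, T = 𝓑.killing (𝓑.embed y) := ⟨_, rfl⟩
  obtain ⟨dE, hdE⟩ : ∃ dE : EuclideanSpace ℝ (Fin 3) →L[ℝ] E4,
    dE = mfderiv (𝓡 3) (𝓡 4) 𝓑.embed y := ⟨_, rfl⟩
  obtain ⟨g, hg⟩ : ∃ g : E4 →L[ℝ] E4 →L[ℝ] ℝ, g = 𝓑.metric.val (𝓑.embed y) := ⟨_, rfl⟩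
  obtain ⟨hh, hhh⟩ : ∃ hh : EuclideanSpace ℝ (Fin 3) →L[ℝ] EuclideanSpace ℝ (Fin 3) →L[ℝ] ℝ,
    hh = 𝓑.D.h.inner y := ⟨_, rfl⟩
  rw [← hTd, ← hdE]
  -- the induced metric is the Riemannian `h`; `h` is positive; `T` is timelike
  have hind : ∀ w, g (dE w) (dE w) = hh w w := fun w ↦ by
    have h := congrArg (fun B ↦ B w w) (𝓑.induced_h y)
    simp only [pullbackBilin_apply] at h
    rw [hg, hdE, hhh]
    exact h
  have hpos : ∀ w, w ≠ 0 → 0 < hh w w := fun w hw ↦ by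
    rw [hhh]
    exact 𝓑.D.h.pos y w hw
  have hTT : g T T < 0 := by
    rw [hg, hTd]
    exact hT
  -- trivial kernel
  have hker : ∀ (τ : ℝ) (w : EuclideanSpace ℝ (Fin 3)), τ • T + dE w = 0 → τ = 0 ∧ w = 0 := by
    intro τ w h0
    have hdEw : dE w = -(τ • T) := eq_neg_of_add_eq_zero_right h0
    have h1 : hh w w = τ * τ * g T T := by
      rw [← hind w, hdEw]
      simp only [map_neg, map_smul]
      simp
      ring
    have hnn : 0 ≤ hh w w := by
      rcases eq_or_ne w 0 with rfl | hw
      · simp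
      · exact (hpos w hw).le
    have hτ : τ = 0 := by
      by_contra hτ
      have : τ * τ * g T T < 0 := mul_neg_of_pos_of_neg (mul_self_pos.2 hτ) hTT
      linarith
    subst hτ
    have hw0 : dE w = 0 := by rw [hdEw, zero_smul, neg_zero]
    refine ⟨rfl, ?_⟩
    by_contra hw
    have hp := hpos w hw
    rw [← hind w, hw0, map_zero] at hp
    exact lt_irrefl _ (by simpa only using hp)
  -- injectivity of the (linear) map
  rintro ⟨τ, w⟩ ⟨τ', w'⟩ hvv'
  simp only at hvv'
  have h0 : (τ - τ') • T + dE (w - w') = 0 := by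
    rw [sub_smul, map_sub]
    have : τ • T + dE w - (τ' • T + dE w') = 0 := sub_eq_zero.2 hvv'
    rw [← this]
    abel
  obtain ⟨h1, h2⟩ := hker _ _ h0
  rw [sub_eq_zero.1 h1, sub_eq_zero.1 h2]

omit [𝓑.metric.HasLeviCivita] in
/-- **The differential of the flow-out map is onto** at every `(t, y)` with `T` timelike at
`embed y` (in particular for `y ∈ Σ_ext' = e.far (e.R + 1)`): `dΦ_{(t,y)}(τ, w) = τ T_{Φ(t,y)} +
dθₜ(d(embed)_y w) = dθₜ(τ T_{embed y} + d(embed)_y w)` (`dθₜ T = T ∘ θₜ`,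
`mfderiv_flow_apply_self`; chain rule), `dθₜ` is onto (`dθₜ ∘ dθ₋ₜ = id`), and
`(τ, w) ↦ τ T + d(embed) w` is an injective linear map `ℝ × ℝ³ → ℝ⁴`, hence onto
(`injective_smul_killing_add_mfderiv_embed`). Lee 2012, Thm. 9.20 (flow-out theorem) in the
transversal case; Chruściel–Costa 2008, §2.2. [cite: LeeSmoothManifolds2013, Thm. 9.20] [cite: ChruscielCosta2008, §2.2 (2.1)] -/
theorem mfderiv_flowOut_surjective {θ : ℝ × 𝓑.carrier → 𝓑.carrier}
    (hθ : ContMDiff (𝓘(ℝ, ℝ).prod (𝓡 4)) (𝓡 4) ∞ θ) (hθ0 : ∀ p, θ (0, p) = p)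
    (hθadd : ∀ t s p, θ (t, θ (s, p)) = θ (t + s, p))
    (hθX : ∀ p, IsMIntegralCurve (fun t ↦ θ (t, p)) 𝓑.killing) (t : ℝ) (y : 𝓑.X)
    (hT : 𝓑.metric.IsTimelike (𝓑.killing (𝓑.embed y))) :
    Surjective (mfderiv (𝓘(ℝ, ℝ).prod (𝓡 3)) (𝓡 4)
      (fun q : ℝ × 𝓑.X ↦ θ (q.1, 𝓑.embed q.2)) (t, y)) := by
  have hθ2 : ContMDiff (𝓘(ℝ, ℝ).prod (𝓡 4)) (𝓡 4) 2 θ := hθ.of_le (WithTop.coe_le_coe.mpr le_top)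
  have hΦd : MDifferentiableAt (𝓘(ℝ, ℝ).prod (𝓡 3)) (𝓡 4)
      (fun q : ℝ × 𝓑.X ↦ θ (q.1, 𝓑.embed q.2)) (t, y) :=
    (𝓑.contMDiff_flowOut hθ).contMDiffAt.mdifferentiableAt (by simp)
  have hEd : MDifferentiableAt (𝓡 3) (𝓡 4) 𝓑.embed y :=
    𝓑.isSmoothEmbedding.contMDiff.contMDiffAt.mdifferentiableAt (by simp)
  -- the two partial derivatives
  have hpt : ∀ τ : ℝ, mfderiv 𝓘(ℝ, ℝ) (𝓡 4) (fun s : ℝ ↦ θ (s, 𝓑.embed y)) t τ =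
      τ • 𝓑.killing (θ (t, 𝓑.embed y)) := fun τ ↦ by
    rw [(hθX (𝓑.embed y) t).mfderiv]
    rfl
  have hpy : mfderiv (𝓡 3) (𝓡 4) (fun z : 𝓑.X ↦ θ (t, 𝓑.embed z)) y =
      (mfderiv (𝓡 4) (𝓡 4) (fun q ↦ θ (t, q)) (𝓑.embed y)).comp
        (mfderiv (𝓡 3) (𝓡 4) 𝓑.embed y) := by
    have hc : (fun z : 𝓑.X ↦ θ (t, 𝓑.embed z)) = (fun q ↦ θ (t, q)) ∘ 𝓑.embed := rfl
    rw [hc, mfderiv_comp y (PseudoRiemannianMetric.mdifferentiableAt_flow hθ2 t (𝓑.embed y)) hEd]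
  -- `dΦ(τ, w) = dθₜ(τ T + d(embed) w)`
  have hformula : ∀ v : TangentSpace (𝓘(ℝ, ℝ).prod (𝓡 3)) (t, y),
      mfderiv (𝓘(ℝ, ℝ).prod (𝓡 3)) (𝓡 4) (fun q : ℝ × 𝓑.X ↦ θ (q.1, 𝓑.embed q.2)) (t, y) v =
        mfderiv (𝓡 4) (𝓡 4) (fun q ↦ θ (t, q)) (𝓑.embed y)
          (v.1 • 𝓑.killing (𝓑.embed y) + mfderiv (𝓡 3) (𝓡 4) 𝓑.embed y v.2) := by
    intro v
    rw [mfderiv_prod_eq_add_apply hΦd]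
    show mfderiv 𝓘(ℝ, ℝ) (𝓡 4) (fun s : ℝ ↦ θ (s, 𝓑.embed y)) t v.1 +
        mfderiv (𝓡 3) (𝓡 4) (fun z : 𝓑.X ↦ θ (t, 𝓑.embed z)) y v.2 = _
    rw [hpt, hpy, map_add, map_smul, mfderiv_flow_apply_self hθ2 hθ0 hθadd hθX t (𝓑.embed y)]
    rfl
  -- the linear map `(τ, w) ↦ τ T + d(embed) w` is injective, hence onto (`1 + 3 = 4`)
  obtain ⟨T, hTd⟩ : ∃ T : E4, T = 𝓑.killing (𝓑.embed y) := ⟨_, rfl⟩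
  obtain ⟨dE, hdE⟩ : ∃ dE : EuclideanSpace ℝ (Fin 3) →L[ℝ] E4,
    dE = mfderiv (𝓡 3) (𝓡 4) 𝓑.embed y := ⟨_, rfl⟩
  let L : (ℝ × EuclideanSpace ℝ (Fin 3)) →ₗ[ℝ] E4 :=
    (LinearMap.fst ℝ ℝ (EuclideanSpace ℝ (Fin 3))).smulRight T +
      (dE : EuclideanSpace ℝ (Fin 3) →ₗ[ℝ] E4).comp (LinearMap.snd ℝ ℝ (EuclideanSpace ℝ (Fin 3)))
  have hLapply : ∀ v : ℝ × EuclideanSpace ℝ (Fin 3), L v = v.1 • T + dE v.2 := fun v ↦ by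
    simp [L]
  have hinj := 𝓑.injective_smul_killing_add_mfderiv_embed y hT
  rw [← hTd, ← hdE] at hinj
  have hLinj : Injective L := fun v v' h ↦ hinj (by rw [hLapply, hLapply] at h; exact h)
  have hdim : Module.finrank ℝ (ℝ × EuclideanSpace ℝ (Fin 3)) = Module.finrank ℝ E4 := by
    rw [Module.finrank_prod, Module.finrank_self, finrank_euclideanSpace_fin,
      finrank_euclideanSpace_fin]
  have hLsurj : Surjective L :=
    (LinearMap.injective_iff_surjective_of_finrank_eq_finrank hdim).1 hLinj
  -- conclusion: `u = dθₜ(dθ₋ₜ u)` and `dθ₋ₜ u = L v` for some `v`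
  intro u
  obtain ⟨v, hv⟩ := hLsurj (mfderiv (𝓡 4) (𝓡 4) (fun q ↦ θ (-t, q)) (θ (t, 𝓑.embed y)) u)
  refine ⟨v, ?_⟩
  rw [hformula v]
  have hv' : v.1 • 𝓑.killing (𝓑.embed y) + mfderiv (𝓡 3) (𝓡 4) 𝓑.embed y v.2 =
      mfderiv (𝓡 4) (𝓡 4) (fun q ↦ θ (-t, q)) (θ (t, 𝓑.embed y)) u := by
    rw [← hv, hLapply, hTd, hdE]
    rfl
  rw [hv']
  have h := PseudoRiemannianMetric.mfderiv_flow_neg_apply_mfderiv_flow hθ2 hθ0 hθadd (-t)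
    (θ (t, 𝓑.embed y)) u
  rw [neg_neg, flow_neg_apply_flow hθ0 hθadd t (𝓑.embed y)] at h
  exact h

/-- **The asymptotic region `M_ext = ⋃ₜ φₜ(Σ_ext')` is open.** It is the image of the open set
`ℝ × e.far (e.R + 1)` under the flow-out map `Φ(t, y) = θ(t, embed y)` of the (smooth, global)
stationary flow, whose differential is onto at every point (`mfderiv_flowOut_surjective`: `T` is
timelike on `Σ_ext' ⊆ M_ext`, transversal to the spacelike `Σ_ext'`), and such maps are open
(`isOpen_image_of_mfderiv_surjective`). Chruściel–Costa 2008, §2.2 ((2.1), `M_ext` "the exterior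
region"). [cite: ChruscielCosta2008, §2.2 (2.1)] [cite: LeeSmoothManifolds2013, Prop. 4.28 and Thm. 9.20] -/
theorem isOpen_Mext : IsOpen 𝓑.Mext := by
  obtain ⟨θ, hθ, hθ0, hθadd, hθX, -⟩ := 𝓑.exists_stationary_flow
  rw [𝓑.Mext_eq_image_flowOut hθ0 hθX]
  refine isOpen_image_of_mfderiv_surjective (isOpen_univ.prod (𝓑.e.isOpen_far _))
    (fun q _ ↦ ((𝓑.contMDiff_flowOut hθ).of_le (WithTop.coe_le_coe.mpr le_top)).contMDiffAt)
    ?_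
  rintro ⟨t, y⟩ ⟨-, hy⟩
  exact 𝓑.mfderiv_flowOut_surjective hθ hθ0 hθadd hθX t y
    (𝓑.isStationaryKilling.isTimelike (𝓑.image_far_subset_Mext ⟨y, hy, rfl⟩)).1

/-- `M_ext` is a neighbourhood of each of its points. [cite: ChruscielCosta2008, §2.2 (2.1)] -/
theorem Mext_mem_nhds {x : 𝓑.carrier} (hx : x ∈ 𝓑.Mext) : 𝓑.Mext ∈ 𝓝 x :=
  𝓑.isOpen_Mext.mem_nhds hx

end StationaryAFBlackHole

end Literature.Geometry.Lorentzian
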